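import Literature.MathematicalPhysics.StatisticalMechanics.KosterlitzThoulessStiffnessBound
import HarnessLib

/-!
# The Kosterlitz–Thouless stiffness bound for SPATIALLY ANISOTROPIC stiffness: `T_c ≤ (π/2)·√(ρ̄_x ρ̄_y)`

Topic `Literature/MathematicalPhysics/StatisticalMechanics`; companion of `KosterlitzThoulessStiffnessBound`
(its "Not here" item «no anisotropic version (Hazra–Verma–Randeria App. H)», now supplied). Same conventions
(`k_B = 1`, phase stiffness in energy units normalised by `(J/2)∫|∇φ|²`, a stiffness PROFILE is a function
`ℝ → ℝ`), same status: the physics input is a `Prop`-valued HYPOTHESIS on the profiles, the deductions are PROVED.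

## The physics (Hazra–Verma–Randeria 2019, App. H, verbatim where quoted)

For direction-dependent stiffnesses `J_x, J_y` ("various quantities … are different in different directions
labeled by `a = x, y`"; `D_{s,a}(T) ≤ D̃_a(T)`, eq. (H1)) the phase-only free energy is
`𝓕 = ½ ∫ dx dy [J_x (∂_x θ)² + J_y (∂_y θ)²]` (eq. (H5)); the area-preserving rescaling
`x' = (J_y/J_x)^{1/4} x`, `y' = (J_x/J_y)^{1/4} y` gives `𝓕 = ½ (J_x J_y)^{1/2} ∫ dx' dy' [(∂_{x'}θ)² + (∂_{y'}θ)²]`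
(eq. (H6)): "the line of fixed points below `T_c` are actually described by a Gaussian theory and the BKT `T_c`
is precisely when vortex-antivortex unbinding becomes relevant at a Gaussian fixed point", hence the
Nelson–Kosterlitz relation `k_B T_c = (π/2) (D_{s,x}(T_c⁻) D_{s,y}(T_c⁻))^{1/2}` (eq. (H3)) and "the improved
bound" `k_B T_c ≤ (π/2) (D̃_x D̃_y)^{1/2}` (eq. (H4)); "the most conservative bound on `T_c` in 2D is then
`k_B T_c ≤ (π/2) max{D̃_x, D̃_y}`" (eq. (H2)), "clearly … not optimal because we expect `T_c` to go to zero if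
either `D_{s,x}` or `D_{s,y}` goes to zero".

## How it is typed (no new predicate)

The anisotropic Kosterlitz–Thouless stability input is the ISOTROPIC predicate
`KosterlitzThouless.StableBelow` of the companion file applied to the GEOMETRIC-MEAN profile:
`StableBelow (fun T => √(ρx T * ρy T)) Tc`, i.e. `(2/π)·T ≤ √(ρ_x(T)·ρ_y(T))` for `0 < T < Tc`. PROVED here:

* `stableBelow_sqrt_mul_self_iff` — for `ρ_x = ρ_y = ρ ≥ 0` it IS the isotropic hypothesis;
* `stableBelow_sqrt_mul_of_stableBelow` — stability in each direction separately implies it (it is the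
  WEAKER, hence more robust, input); `pos_of_stableBelow_sqrt_mul` — under it both stiffnesses are positive
  on `(0, Tc)` as soon as one is nonnegative;
* `le_pi_div_two_mul_sqrt_of_stableBelow` — **the anisotropic bound of record** (eq. (H4)): ceilings
  `ρ_x ≤ a`, `ρ_y ≤ b` on `(0, Tc)` (and `ρ_x ≥ 0` there) give `Tc ≤ (π/2)·√(a·b)`;
* corollaries: the "most conservative" `Tc ≤ (π/2)·max{a, b}` (eq. (H2), `le_pi_div_two_mul_max_of_stableBelow_sqrt`);
  for every `λ > 0` the weighted arithmetic-mean form `Tc ≤ (π/4)·(λa + b/λ)`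
  (`le_pi_div_four_mul_weighted_of_stableBelow_sqrt`) — the form in which two PER-DIRECTION f-sum / kinetic
  ceilings of an anisotropic-hopping lattice model are consumed WITHOUT any lattice-rotation symmetry
  (`λ = √(t_y/t_x)` makes the weighted one-body symbol `λ·t_x cos k_x + λ⁻¹·t_y cos k_y` isotropic, so the
  isotropic bathtub tables apply verbatim with `t ↦ √(t_x t_y)`); `λ = 1`: `Tc ≤ (π/4)·(a + b)`
  (`le_pi_div_four_mul_add_of_stableBelow_sqrt`), which for `a = b` is the isotropic bound;
* `le_pi_div_four_mul_sqrt_of_pairTwistCeilings` — the charge-2 (Cooper-pair) reading in twist-coefficient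
  units, `Tc ≤ (π/4)·√(ρ̄ₑₓ·ρ̄ₑᵧ)` (companion of `le_pi_div_four_mul_of_pairTwistCeiling`).

HONEST FRAMING: the anisotropy is IN-PLANE (`x` versus `y` of one two-dimensional system), not layered /
three-dimensional; the stability hypothesis is a renormalisation-group prediction carried as a hypothesis,
exactly as in the isotropic file; nothing here is specific to one microscopic model and nothing here is a
`T_c` estimate. Written for the hubbard-tc cell (MO-S3 `T_c` back-end; seat p1, 2026-08-27) so that
rectangular / orthorhombic / coupled-chain units can be read with two directional ceilings.

## References

* T. Hazra, N. Verma, M. Randeria, Phys. Rev. X 9 (2019) 031049 (arXiv:1811.12428), App. H, eqs. (H1)–(H6);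
  main text after eq. (3): "We can use `D̃ = max{D̃_x, D̃_y}` to obtain a bound on `T_c`, however, we argue in
  Appendix H for a much stronger result `D̃ = [D̃_x D̃_y]^{1/2}` in 2D". [HazraVermaRanderia2019]
* D. R. Nelson, J. M. Kosterlitz, Phys. Rev. Lett. 39 (1977) 1201. [NelsonKosterlitz1977]
-/

noncomputable section

open Filter Topology Set Real

namespace Literature.MathematicalPhysics.StatisticalMechanics

namespace KosterlitzThouless

variable {ρ : ℝ → ℝ} {Tc : ℝ}

section Anisotropic

variable {ρx ρy : ℝ → ℝ} {a b : ℝ}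

/-- **Isotropic consistency.** For a profile that is nonnegative on `(0, Tc)`, the geometric-mean
hypothesis with `ρ_x = ρ_y = ρ` IS the §1 stability inequality (`√(ρ·ρ) = ρ`).
[cite: HazraVermaRanderia2019, App. H eq. (H3)] -/
theorem stableBelow_sqrt_mul_self_iff (h0 : ∀ ⦃T : ℝ⦄, 0 < T → T < Tc → 0 ≤ ρ T) :
    StableBelow (fun T => √(ρ T * ρ T)) Tc ↔ StableBelow ρ Tc := by
  constructor
  · intro h T hT hTTc
    have h1 := h hT hTTc
    simpa only [Real.sqrt_mul_self (h0 hT hTTc)] using h1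
  · intro h T hT hTTc
    have h1 := h hT hTTc
    simpa only [Real.sqrt_mul_self (h0 hT hTTc)] using h1

/-- **Stability in each direction implies stability of the geometric mean** (the geometric mean of two
numbers `≥ (2/π)T ≥ 0` is `≥ (2/π)T`): the anisotropic hypothesis is the WEAKER input.
[cite: HazraVermaRanderia2019, App. H eqs. (H3)–(H4)] -/
theorem stableBelow_sqrt_mul_of_stableBelow (hx : StableBelow ρx Tc) (hy : StableBelow ρy Tc) :
    StableBelow (fun T => √(ρx T * ρy T)) Tc := by
  intro T hT hTTc
  have h1 := hx hT hTTc
  have h2 := hy hT hTTc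
  have hc : 0 ≤ 2 / π * T := by positivity
  have hsq : (2 / π * T) * (2 / π * T) ≤ ρx T * ρy T := mul_le_mul h1 h2 hc (hc.trans h1)
  calc 2 / π * T = √((2 / π * T) * (2 / π * T)) := (Real.sqrt_mul_self hc).symm
    _ ≤ √(ρx T * ρy T) := Real.sqrt_le_sqrt hsq

/-- Under the geometric-mean stability inequality, if one directional stiffness is nonnegative on
`(0, Tc)` then BOTH are strictly positive there (`√(ρ_x ρ_y) ≥ (2/π)T > 0` forces `ρ_x ρ_y > 0`).
[cite: HazraVermaRanderia2019, App. H eq. (H3)] -/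
theorem pos_of_stableBelow_sqrt_mul (h : StableBelow (fun T => √(ρx T * ρy T)) Tc)
    (hx0 : ∀ ⦃T : ℝ⦄, 0 < T → T < Tc → 0 ≤ ρx T) {T : ℝ} (hT : 0 < T) (hTTc : T < Tc) :
    0 < ρx T ∧ 0 < ρy T := by
  have hpos : 0 < √(ρx T * ρy T) := lt_of_lt_of_le (by positivity) (h hT hTTc)
  have hprod : 0 < ρx T * ρy T := Real.sqrt_pos.1 hpos
  have hx : 0 < ρx T := by
    rcases (hx0 hT hTTc).eq_or_lt with h0 | h0
    · exfalso
      rw [← h0, zero_mul] at hprod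
      exact lt_irrefl _ hprod
    · exact h0
  have hy : 0 < ρy T := by
    by_contra hy
    push Not at hy
    nlinarith [mul_nonneg hx.le (neg_nonneg.2 hy)]
  exact ⟨hx, hy⟩

/-- **The anisotropic bound of record** (Hazra–Verma–Randeria 2019, App. H eq. (H4)
`k_B T_c ≤ (π/2)(D̃_x D̃_y)^{1/2}`): if the geometric-mean profile obeys the stability inequality below
`Tc > 0`, `ρ_x ≥ 0` on `(0, Tc)`, and `ρ_x ≤ a`, `ρ_y ≤ b` there, then `Tc ≤ (π/2)·√(a·b)`.
[cite: HazraVermaRanderia2019, App. H eq. (H4)] -/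
theorem le_pi_div_two_mul_sqrt_of_stableBelow (h : StableBelow (fun T => √(ρx T * ρy T)) Tc)
    (hTc : 0 < Tc) (hx0 : ∀ ⦃T : ℝ⦄, 0 < T → T < Tc → 0 ≤ ρx T)
    (hxa : ∀ ⦃T : ℝ⦄, 0 < T → T < Tc → ρx T ≤ a) (hyb : ∀ ⦃T : ℝ⦄, 0 < T → T < Tc → ρy T ≤ b) :
    Tc ≤ π / 2 * √(a * b) :=
  le_pi_div_two_mul_of_stableBelow (ρ := fun T => √(ρx T * ρy T)) (ρbar := √(a * b)) h hTc
    fun T hT hTTc => by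
      obtain ⟨hx, hy⟩ := pos_of_stableBelow_sqrt_mul h hx0 hT hTTc
      exact Real.sqrt_le_sqrt
        (mul_le_mul (hxa hT hTTc) (hyb hT hTTc) hy.le (hx.le.trans (hxa hT hTTc)))

/-- Nonnegativity of the two ceilings under the hypotheses of the anisotropic bound (read at `T = Tc/2`).
[cite: HazraVermaRanderia2019, App. H eq. (H4)] -/
theorem ceilings_nonneg_of_stableBelow_sqrt (h : StableBelow (fun T => √(ρx T * ρy T)) Tc)
    (hTc : 0 < Tc) (hx0 : ∀ ⦃T : ℝ⦄, 0 < T → T < Tc → 0 ≤ ρx T)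
    (hxa : ∀ ⦃T : ℝ⦄, 0 < T → T < Tc → ρx T ≤ a) (hyb : ∀ ⦃T : ℝ⦄, 0 < T → T < Tc → ρy T ≤ b) :
    0 ≤ a ∧ 0 ≤ b := by
  have hT : 0 < Tc / 2 := by linarith
  have hTTc : Tc / 2 < Tc := by linarith
  obtain ⟨hx, hy⟩ := pos_of_stableBelow_sqrt_mul h hx0 hT hTTc
  exact ⟨hx.le.trans (hxa hT hTTc), hy.le.trans (hyb hT hTTc)⟩

/-- **The "most conservative" anisotropic bound** (Hazra–Verma–Randeria 2019, App. H eq. (H2)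
`k_B T_c ≤ (π/2) max{D̃_x, D̃_y}`), as a COROLLARY of the geometric-mean bound (`√(ab) ≤ max{a, b}`).
[cite: HazraVermaRanderia2019, App. H eq. (H2)] -/
theorem le_pi_div_two_mul_max_of_stableBelow_sqrt (h : StableBelow (fun T => √(ρx T * ρy T)) Tc)
    (hTc : 0 < Tc) (hx0 : ∀ ⦃T : ℝ⦄, 0 < T → T < Tc → 0 ≤ ρx T)
    (hxa : ∀ ⦃T : ℝ⦄, 0 < T → T < Tc → ρx T ≤ a) (hyb : ∀ ⦃T : ℝ⦄, 0 < T → T < Tc → ρy T ≤ b) :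
    Tc ≤ π / 2 * max a b := by
  have h1 := le_pi_div_two_mul_sqrt_of_stableBelow h hTc hx0 hxa hyb
  obtain ⟨ha, hb⟩ := ceilings_nonneg_of_stableBelow_sqrt h hTc hx0 hxa hyb
  have hm0 : 0 ≤ max a b := ha.trans (le_max_left a b)
  have hsq : a * b ≤ (max a b) ^ 2 := by
    rw [sq]
    exact mul_le_mul (le_max_left a b) (le_max_right a b) hb hm0
  have h2 : √(a * b) ≤ max a b := by
    calc √(a * b) ≤ √((max a b) ^ 2) := Real.sqrt_le_sqrt hsq
      _ = max a b := Real.sqrt_sq hm0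
  have hπ : 0 < π := Real.pi_pos
  nlinarith [h1, h2, hπ]

/-- **Weighted arithmetic-mean form**: for every `λ > 0`, `Tc ≤ (π/4)·(λ·a + b/λ)`
(`√(ab) = √((λa)(b/λ)) ≤ (λa + b/λ)/2`). This is the form in which two per-direction ceilings of an
anisotropic-hopping model are consumed without lattice-rotation symmetry: `λ` rebalances the two
directions (for hoppings `t_x, t_y` the choice `λ = √(t_y/t_x)` makes the combined one-body symbol
isotropic). [cite: HazraVermaRanderia2019, App. H eq. (H4)] -/
theorem le_pi_div_four_mul_weighted_of_stableBelow_sqrt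
    (h : StableBelow (fun T => √(ρx T * ρy T)) Tc) (hTc : 0 < Tc)
    (hx0 : ∀ ⦃T : ℝ⦄, 0 < T → T < Tc → 0 ≤ ρx T)
    (hxa : ∀ ⦃T : ℝ⦄, 0 < T → T < Tc → ρx T ≤ a) (hyb : ∀ ⦃T : ℝ⦄, 0 < T → T < Tc → ρy T ≤ b)
    {l : ℝ} (hl : 0 < l) : Tc ≤ π / 4 * (l * a + b / l) := by
  have h1 := le_pi_div_two_mul_sqrt_of_stableBelow h hTc hx0 hxa hyb
  obtain ⟨ha, hb⟩ := ceilings_nonneg_of_stableBelow_sqrt h hTc hx0 hxa hyb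
  have hm0 : 0 ≤ (l * a + b / l) / 2 := by positivity
  have hprod : a * b = (l * a) * (b / l) := by field_simp
  have hsq : a * b ≤ ((l * a + b / l) / 2) ^ 2 := by
    rw [hprod]
    nlinarith [sq_nonneg (l * a - b / l)]
  have h2 : √(a * b) ≤ (l * a + b / l) / 2 := by
    calc √(a * b) ≤ √(((l * a + b / l) / 2) ^ 2) := Real.sqrt_le_sqrt hsq
      _ = (l * a + b / l) / 2 := Real.sqrt_sq hm0
  have hπ : 0 < π := Real.pi_pos
  nlinarith [h1, h2, hπ]

/-- **Arithmetic-mean form** `Tc ≤ (π/4)·(a + b)` (the weighted form at `λ = 1`; for `a = b` it is the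
isotropic bound of §2). [cite: HazraVermaRanderia2019, App. H eq. (H4)] -/
theorem le_pi_div_four_mul_add_of_stableBelow_sqrt (h : StableBelow (fun T => √(ρx T * ρy T)) Tc)
    (hTc : 0 < Tc) (hx0 : ∀ ⦃T : ℝ⦄, 0 < T → T < Tc → 0 ≤ ρx T)
    (hxa : ∀ ⦃T : ℝ⦄, 0 < T → T < Tc → ρx T ≤ a) (hyb : ∀ ⦃T : ℝ⦄, 0 < T → T < Tc → ρy T ≤ b) :
    Tc ≤ π / 4 * (a + b) := by
  have h1 := le_pi_div_four_mul_weighted_of_stableBelow_sqrt h hTc hx0 hxa hyb one_pos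
  simpa only [one_mul, div_one] using h1

/-- **The anisotropic bound in twist-coefficient units for a paired (charge-2) order parameter**: if the
geometric mean of the two pair-phase stiffnesses `T ↦ ρₑₓ(T)/2`, `T ↦ ρₑᵧ(T)/2` obeys the stability
inequality below `Tc > 0`, `ρₑₓ ≥ 0` on `(0, Tc)`, and the two particle-phase twist coefficients obey
`ρₑₓ ≤ ρ̄ₑₓ`, `ρₑᵧ ≤ ρ̄ₑᵧ` there, then `Tc ≤ (π/4)·√(ρ̄ₑₓ·ρ̄ₑᵧ)` (for `ρ̄ₑₓ = ρ̄ₑᵧ` this is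
`le_pi_div_four_mul_of_pairTwistCeiling`). [cite: HazraVermaRanderia2019, App. H eq. (H4)] -/
theorem le_pi_div_four_mul_sqrt_of_pairTwistCeilings {ρex ρey : ℝ → ℝ} {ax bx : ℝ}
    (h : StableBelow (fun T => √(phaseStiffnessOfTwistCoeff 2 (ρex T) *
      phaseStiffnessOfTwistCoeff 2 (ρey T))) Tc) (hTc : 0 < Tc)
    (hx0 : ∀ ⦃T : ℝ⦄, 0 < T → T < Tc → 0 ≤ ρex T)
    (hxa : ∀ ⦃T : ℝ⦄, 0 < T → T < Tc → ρex T ≤ ax) (hyb : ∀ ⦃T : ℝ⦄, 0 < T → T < Tc → ρey T ≤ bx) :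
    Tc ≤ π / 4 * √(ax * bx) := by
  have hx0' : ∀ ⦃T : ℝ⦄, 0 < T → T < Tc → 0 ≤ phaseStiffnessOfTwistCoeff 2 (ρex T) := fun T hT hTTc => by
    rw [phaseStiffnessOfTwistCoeff_two]
    exact div_nonneg (hx0 hT hTTc) zero_le_two
  have hxa' : ∀ ⦃T : ℝ⦄, 0 < T → T < Tc → phaseStiffnessOfTwistCoeff 2 (ρex T) ≤ ax / 2 :=
    fun T hT hTTc => by
      rw [phaseStiffnessOfTwistCoeff_two]
      exact div_le_div_of_nonneg_right (hxa hT hTTc) zero_le_two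
  have hyb' : ∀ ⦃T : ℝ⦄, 0 < T → T < Tc → phaseStiffnessOfTwistCoeff 2 (ρey T) ≤ bx / 2 :=
    fun T hT hTTc => by
      rw [phaseStiffnessOfTwistCoeff_two]
      exact div_le_div_of_nonneg_right (hyb hT hTTc) zero_le_two
  have h1 := le_pi_div_two_mul_sqrt_of_stableBelow h hTc hx0' hxa' hyb'
  obtain ⟨ha, hb⟩ := ceilings_nonneg_of_stableBelow_sqrt h hTc hx0' hxa' hyb'
  have hax : 0 ≤ ax := by linarith
  have hbx : 0 ≤ bx := by linarith
  have hnn : 0 ≤ ax * bx := mul_nonneg hax hbx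
  have key : √(ax / 2 * (bx / 2)) = √(ax * bx) / 2 := by
    have h2 : 0 ≤ √(ax * bx) / 2 := by positivity
    rw [← Real.sqrt_sq h2, div_pow, Real.sq_sqrt hnn]
    congr 1
    ring
  rw [key] at h1
  linarith

end Anisotropic

end KosterlitzThouless

end Literature.MathematicalPhysics.StatisticalMechanics

end
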